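import Summits.CriticalPhenomena.PercolationContinuityZ3.Theorems.Transplant.FKConnectivityAllQAntipodalAndGenPath
import Summits.CriticalPhenomena.PercolationContinuityZ3.Theorems.Transplant.FKConnectivityAllQAntipodalBridge
import HarnessLib

/-!
# Connectivity correlation inequalities for `φ_{w,q}`, every `q > 0` — file 33: **AND EVENTS ARE NEGATIVELY CORRELATED WITH INCREASING EVENTS
# under the random-cluster measure `φ_{w,q}`, `q ≤ 1`, on every 2-connected series–parallel graph** (value-level form of Conjecture `C_∞`)

Support file (`--supports stmt-CriticalPhenomena-4575`), FK sub-lane `prim-bschramm-fk-2` (gen 19) of the post-continuity programme; builds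
on p205010 (kernel theorem, internal audit signed; external expert review pending).  No definitions, no named facts, no sorries; standard axioms.

File 32c proved gen 10's Conjecture `C_∞` for the AND type coefficientwise: every cell `apPsiC q S σ 1̂_{S₀ ⊆ ·} 1̂_F` inside a 2-connected
series–parallel host is `≤ 0` (`0 < q ≤ 1`).  fk-3's antipodal bridge (`two_mul_cov_eq_sum_cells`: `2(Z·Z[fg] − Z[f]Z[g]) = ∑_{cells} (cell
weight ≥ 0) · apPsiC`) turns cell signs into covariance signs for every edge-weight vector; here we restrict it to the cells inside the support
of `w` (the other cell weights vanish) and obtain the VALUE-LEVEL theorem: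
**`FK.rcMeasureW_and_inter_le_of_isTTSP`** — for `E` TTSP between `s, t` with `st ∉ E`, every `w ∈ [0,1]^{Sym2 V}` supported in `H = E ∪ {st}`
(an arbitrary 2-connected series–parallel weighted graph), every `0 < q ≤ 1`, every finite edge set `S₀` and every increasing event `F` that does
not depend on the edges of `S₀`:  `φ_{w,q}({S₀ open} ∩ F) ≤ φ_{w,q}(S₀ open) · φ_{w,q}(F)`.
For `|S₀| = 1` this is the single-edge negative dependence of gen 8 (`edgeNegDep_of_isTTSP`, there for `q < 1` by a different route); for general
`S₀` it is the negative correlation of every AND (cylinder-up) event with every increasing event off its support — the `q ≤ 1` random-cluster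
measure on series–parallel graphs is "negatively associated against AND events".  (At `q = 1` both sides agree: independence.)
HONEST SCOPE: at the VALUE level (and for `q < 1`) this inequality also follows from gen 8's single-edge theorem
`FK.edgeNegDep_supp_of_isTTSP` by iterated conditioning (`φ_w(· | e open) = φ_{w[e ↦ 1]}`, the support is unchanged), so the value-level
statement is a consolidation, not a new strength; what is new is the COEFFICIENTWISE theorem of file 32c behind it (every cell, i.e. every
coefficient of `Z_H² Cov` in all edge variables, is signed — the `z_e`-linear coefficients are two-replica (deleted × contracted) quantities
that no iteration of the single-edge statement reaches), and the present file records that the bridge turns it into the measure statement.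
The OR event `{some edge of S₀ is open}` is the dual of the AND event and has the SAME antipodal increments (`F_or = F_and`), so the same
cells give **`FK.rcMeasureW_or_inter_le_of_isTTSP`**: `φ_{w,q}({some edge of S₀ open} ∩ F) ≤ φ_{w,q}(some edge of S₀ open) · φ_{w,q}(F)`.
[cite: Grimmett2006, §1.4 eq. (1.20) (p. 15); §3.8 Thm. (3.90) (pp. 61–62); §3.9 (pp. 63–64)] [cite: Wagner2006, Thm. 5.8(d), §5.3]
-/

noncomputable section

namespace Summit.CriticalPhenomena.PercolationContinuityZ3.Theorems

namespace FK

open MeasureTheory Literature.Probability.LatticeModels Literature.Probability.Percolation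
open Literature.Probability.Percolation.DecisionTree (ind ind_of_mem ind_of_not_mem ind_nonneg)
open scoped Classical

variable {V : Type*} [Fintype V]

/-! ### The bridge restricted to the support of the weights -/

/-- **Cells inside the support `≤ 0` ⇒ `Z·Z[fg] ≤ Z[f]·Z[g]`.**  If `w` vanishes off `H` and every cell `(σ, S)` with `σ, S ⊆ H` has
`apPsiC q S σ f̂ ĝ ≤ 0`, then `Z·Z[fg] ≤ Z[f]Z[g]` (the cells meeting `Hᶜ` have zero weight: `∏_σ w² · ∏_S w(1-w)` vanishes).
[cite: Grimmett2006, §1.4 eq. (1.20) (p. 15); §3.8 (pp. 61–62)] -/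
theorem cov_nonpos_of_apPsiC_nonpos_on (w : Sym2 V → unitInterval) (q : ℝ) (f g : BondConfig V → ℝ) (H : Finset (Sym2 V))
    (hw : ∀ e, e ∉ H → ((w e : ℝ)) = 0)
    (h : ∀ σ S : Finset (Sym2 V), S ⊆ Finset.univ \ σ → σ ⊆ H → S ⊆ H → apPsiC q S σ (fun γ => f ↑γ) (fun γ => g ↑γ) ≤ 0) :
    (∑ ω : BondConfig V, rcWeightW w q ∅ ω) * (∑ ω : BondConfig V, rcWeightW w q ∅ ω * (f ω * g ω)) ≤
      (∑ ω : BondConfig V, rcWeightW w q ∅ ω * f ω) * (∑ ω : BondConfig V, rcWeightW w q ∅ ω * g ω) := by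
  rw [sum_bondConfig_eq_sum_powerset (fun ω => rcWeightW w q ∅ ω),
    sum_bondConfig_eq_sum_powerset (fun ω => rcWeightW w q ∅ ω * (f ω * g ω)),
    sum_bondConfig_eq_sum_powerset (fun ω => rcWeightW w q ∅ ω * f ω),
    sum_bondConfig_eq_sum_powerset (fun ω => rcWeightW w q ∅ ω * g ω)]
  have key := two_mul_cov_eq_sum_cells w q f g
  have hle : ∑ σ ∈ (Finset.univ : Finset (Sym2 V)).powerset, ∑ S ∈ (Finset.univ \ σ).powerset,
      ((∏ e ∈ σ, (w e : ℝ) ^ 2) * (∏ e ∈ S, (w e : ℝ) * (1 - w e)) *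
          ∏ e ∈ (Finset.univ \ σ) \ S, (1 - (w e : ℝ)) ^ 2) *
        apPsiC q S σ (fun γ => f ↑γ) (fun γ => g ↑γ) ≤ 0 := by
    refine Finset.sum_nonpos fun σ _ => Finset.sum_nonpos fun S hS => ?_
    by_cases hσ : σ ⊆ H
    · by_cases hSH : S ⊆ H
      · refine mul_nonpos_of_nonneg_of_nonpos ?_ (h σ S (Finset.mem_powerset.1 hS) hσ hSH)
        refine mul_nonneg (mul_nonneg (Finset.prod_nonneg fun e _ => sq_nonneg _)
          (Finset.prod_nonneg fun e _ => mul_nonneg (w e).2.1 (sub_nonneg.2 (w e).2.2))) (Finset.prod_nonneg fun e _ => sq_nonneg _)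
      · -- a free edge of the cell lies outside the support
        obtain ⟨e, heS, heH⟩ := Finset.not_subset.1 hSH
        have hz : ∏ e ∈ S, (w e : ℝ) * (1 - w e) = 0 := Finset.prod_eq_zero heS (by rw [hw e heH, zero_mul])
        rw [hz, mul_zero, zero_mul, zero_mul]
    · -- a contracted edge of the cell lies outside the support
      obtain ⟨e, heσ, heH⟩ := Finset.not_subset.1 hσ
      have hz : ∏ e ∈ σ, (w e : ℝ) ^ 2 = 0 := Finset.prod_eq_zero heσ (by rw [hw e heH]; ring)
      rw [hz, zero_mul, zero_mul, zero_mul]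
  linarith

/-- **Cells inside the support `≤ 0` ⇒ negative correlation under `φ_{w,q}`.**  For `0 < q`, events `A, B`, `w` vanishing off `H`: if
every cell inside `H` has `apPsiC q S σ 1̂_A 1̂_B ≤ 0`, then `φ_{w,q}(A ∩ B) ≤ φ_{w,q}(A) · φ_{w,q}(B)`.
[cite: Grimmett2006, §1.4 eq. (1.20) (p. 15); §3.8 (pp. 61–62)] -/
theorem rcMeasureW_real_inter_le_of_apPsiC_nonpos_on {q : ℝ} (hq : 0 < q) (w : Sym2 V → unitInterval) (H : Finset (Sym2 V))
    (hw : ∀ e, e ∉ H → ((w e : ℝ)) = 0) (A B : Set (BondConfig V))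
    (h : ∀ σ S : Finset (Sym2 V), S ⊆ Finset.univ \ σ → σ ⊆ H → S ⊆ H →
      apPsiC q S σ (fun γ => ind A (↑γ : BondConfig V)) (fun γ => ind B (↑γ : BondConfig V)) ≤ 0) :
    (rcMeasureW w q ∅).real (A ∩ B) ≤ (rcMeasureW w q ∅).real A * (rcMeasureW w q ∅).real B := by
  set Z := rcPartitionFunctionW w q ∅ with hZ
  have hZpos : 0 < Z := rcPartitionFunctionW_pos w hq (∅ : Set V)
  set MA := ∑ ω : BondConfig V, rcWeightW w q ∅ ω * ind A ω with hMA
  set MB := ∑ ω : BondConfig V, rcWeightW w q ∅ ω * ind B ω with hMB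
  set MAB := ∑ ω : BondConfig V, rcWeightW w q ∅ ω * ind (A ∩ B) ω with hMAB
  have key : Z * MAB ≤ MA * MB := by
    have e : MAB = ∑ ω : BondConfig V, rcWeightW w q ∅ ω * (ind A ω * ind B ω) := by
      rw [hMAB]
      refine Finset.sum_congr rfl fun ω _ => ?_
      by_cases hA : ω ∈ A
      · by_cases hB : ω ∈ B
        · rw [ind_of_mem (Set.mem_inter hA hB), ind_of_mem hA, ind_of_mem hB]; ring
        · rw [ind_of_not_mem (fun h' => hB h'.2), ind_of_not_mem hB]; ring
      · rw [ind_of_not_mem (fun h' => hA h'.1), ind_of_not_mem hA]; ring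
    rw [e, hZ]
    unfold rcPartitionFunctionW
    exact cov_nonpos_of_apPsiC_nonpos_on w q (ind A) (ind B) H hw h
  have hab : (rcMeasureW w q ∅).real (A ∩ B) = MAB / Z := by rw [rcMeasureW_real_eq_sum_div w hq ∅]
  have ha : (rcMeasureW w q ∅).real A = MA / Z := by rw [rcMeasureW_real_eq_sum_div w hq ∅]
  have hb : (rcMeasureW w q ∅).real B = MB / Z := by rw [rcMeasureW_real_eq_sum_div w hq ∅]
  rw [hab, ha, hb, show MA / Z * (MB / Z) = (MA * MB) / (Z * Z) by field_simp,
    show MAB / Z = (Z * MAB) / (Z * Z) by field_simp, div_le_div_iff_of_pos_right (mul_pos hZpos hZpos)]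
  exact key

/-! ### The cells of an AND / OR event against an increasing event -/

section Cells

variable {s t : V}

omit [Fintype V] in
/-- An event that does not read the edges of `S₀` is invariant under adjoining any subset of `S₀`. [folklore] -/
theorem ind_union_eq_of_forall_insert {F : Set (BondConfig V)} {S₀ : Finset (Sym2 V)}
    (hFS : ∀ (ω : BondConfig V) (e : Sym2 V), e ∈ S₀ → (insert e ω ∈ F ↔ ω ∈ F)) :
    ∀ (U : Finset (Sym2 V)), U ⊆ S₀ → ∀ A : Finset (Sym2 V), ind F (↑(A ∪ U) : BondConfig V) = ind F (↑A : BondConfig V) := by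
  intro U
  induction U using Finset.induction_on with
  | empty => intro _ A; rw [Finset.union_empty]
  | @insert e U heU ih =>
    intro hU A
    have heS : e ∈ S₀ := hU (Finset.mem_insert_self _ _)
    have hU' : U ⊆ S₀ := fun f hf => hU (Finset.mem_insert_of_mem hf)
    have hset : (↑(A ∪ insert e U) : BondConfig V) = insert e (↑(A ∪ U) : BondConfig V) := by
      rw [Finset.union_insert, Finset.coe_insert]
    rw [hset]
    by_cases hmem : (↑(A ∪ U) : BondConfig V) ∈ F
    · rw [ind_of_mem ((hFS _ e heS).2 hmem), ← ih hU' A, ind_of_mem hmem]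
    · rw [ind_of_not_mem (fun h' => hmem ((hFS _ e heS).1 h')), ← ih hU' A, ind_of_not_mem hmem]

/-- **The reduced AND cell.**  For `T₀ ⊆ S`, `T₀ ⊆ S₀` (`F` increasing, not reading `S₀`), the cell `(σ, S)` of the indicator `1{T₀ ⊆ ·}`
against `1_F` inside the host `H = E ∪ {st}` (`E` TTSP between `s, t`, `st ∉ E`) is `≤ 0`: for `T₀ = ∅` it vanishes, otherwise it is the
cell of file 32c's theorem `apPsiC_and_nonpos_of_isTTSP` with root any edge `e ∈ T₀`, the host re-rooted there (`IsTTSP.reroot_erase`),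
`N = S \ T₀`, `T = T₀ \ {e}`, `C = σ`. [cite: Grimmett2006, §3.8 Thm. (3.90) (pp. 61–62); §3.9 (pp. 63–64)] -/
theorem apPsiC_subsetInd_cell_nonpos {q : ℝ} (hq0 : 0 < q) (hq1 : q ≤ 1) {E : Finset (Sym2 V)} (hE : IsTTSP E s t)
    (hst : s(s, t) ∉ E) {S₀ T₀ : Finset (Sym2 V)} {F : Set (BondConfig V)} (hF : IsUpperSet F)
    (hFS : ∀ (ω : BondConfig V) (e : Sym2 V), e ∈ S₀ → (insert e ω ∈ F ↔ ω ∈ F))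
    {σ S : Finset (Sym2 V)} (hSσ : S ⊆ Finset.univ \ σ) (hσH : σ ⊆ insert s(s, t) E) (hSH : S ⊆ insert s(s, t) E)
    (hTS : T₀ ⊆ S) (hT₀ : T₀ ⊆ S₀) :
    apPsiC q S σ (fun γ => if T₀ ⊆ γ then (1 : ℝ) else 0) (fun γ => ind F (↑γ : BondConfig V)) ≤ 0 := by
  have hdSσ : Disjoint S σ := Finset.disjoint_left.2 fun e he heσ => (Finset.mem_sdiff.1 (hSσ he)).2 heσ
  by_cases hT0 : T₀ = ∅
  · -- no AND edge is free in this cell: the indicator is identically `1`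
    unfold apPsiC
    refine le_of_eq (Finset.sum_eq_zero fun γ _ => ?_)
    dsimp only
    rw [hT0, if_pos (Finset.empty_subset _), if_pos (Finset.empty_subset _), sub_self, zero_mul, mul_zero]
  -- a free AND edge: re-root the host there
  obtain ⟨e, he⟩ := Finset.nonempty_iff_ne_empty.2 hT0
  revert he
  refine Sym2.ind (fun x y => ?_) e
  intro he
  have heS : s(x, y) ∈ S := hTS he
  have heH : s(x, y) ∈ insert s(s, t) E := hSH heS
  have hHne : insert s(s, t) E ≠ {s(x, y)} := by
    intro hh
    obtain ⟨f, hf, _⟩ := hE.left_mem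
    have hf' : f ∈ ({s(x, y)} : Finset (Sym2 V)) := hh ▸ Finset.mem_insert_of_mem hf
    have hs' : s(s, t) ∈ ({s(x, y)} : Finset (Sym2 V)) := hh ▸ Finset.mem_insert_self _ _
    rw [Finset.mem_singleton] at hf' hs'
    exact hst (hs' ▸ hf' ▸ hf)
  have hE' : IsTTSP ((insert s(s, t) E).erase s(x, y)) x y := hE.reroot_erase heH hHne
  -- the cell as the cell of file 32c's theorem: `S = (S \ T₀) ∪ T₀`, root `e ∈ T₀`
  have hSeq : S = (S \ T₀) ∪ insert s(x, y) (T₀.erase s(x, y)) := by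
    rw [Finset.insert_erase he, Finset.sdiff_union_of_subset hTS]
  have hTeq : insert s(x, y) (T₀.erase s(x, y)) = T₀ := Finset.insert_erase he
  have key := apPsiC_and_nonpos_of_isTTSP hq0 hq1 hE' (Finset.notMem_erase _ _)
    (N := S \ T₀) (T := T₀.erase s(x, y)) (C := σ)
    (fun f hf => Finset.mem_erase.2 ⟨fun hh => (Finset.mem_sdiff.1 hf).2 (hh ▸ he), hSH (Finset.sdiff_subset hf)⟩)
    (fun f hf => Finset.mem_erase.2 ⟨(Finset.mem_erase.1 hf).1, hSH (hTS (Finset.mem_of_mem_erase hf))⟩)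
    (fun f hf => Finset.mem_erase.2 ⟨fun hh => (Finset.mem_sdiff.1 (hSσ heS)).2 (hh ▸ hf), hσH hf⟩)
    (Finset.disjoint_of_subset_right (Finset.erase_subset _ _) Finset.sdiff_disjoint)
    (Finset.disjoint_of_subset_left Finset.sdiff_subset hdSσ)
    (Finset.disjoint_of_subset_left ((Finset.erase_subset _ _).trans hTS) hdSσ)
    (g := fun γ => ind F (↑γ : BondConfig V))
    (fun A U hU => ind_union_eq_of_forall_insert hFS U (fun f hf => hT₀ (hTeq ▸ hU hf : f ∈ T₀)) A)
    (fun X Y hXY => by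
      by_cases hX : (↑X : BondConfig V) ∈ F
      · rw [ind_of_mem hX, ind_of_mem (hF (Finset.coe_subset.2 hXY) hX)]
      · rw [ind_of_not_mem hX]; exact ind_nonneg F _)
  rw [← hSeq, hTeq] at key
  exact key

/-- **Every cell of `Z² Cov(1{S₀ open}, 1_F)` inside a 2-connected series–parallel host is `≤ 0`** (`0 < q ≤ 1`, `F` increasing and not
reading `S₀`): for the cell `(σ, S)` the AND indicator restricted to configurations `⊇ σ` is `1{S₀ \ σ ⊆ ·}`; if `S₀ \ σ ⊄ S` the cell
vanishes, otherwise it is a reduced AND cell (`apPsiC_subsetInd_cell_nonpos`).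
[cite: Grimmett2006, §3.8 Thm. (3.90) (pp. 61–62); §3.9 (pp. 63–64)] -/
theorem apPsiC_andEvent_cell_nonpos {q : ℝ} (hq0 : 0 < q) (hq1 : q ≤ 1) {E : Finset (Sym2 V)} (hE : IsTTSP E s t)
    (hst : s(s, t) ∉ E) (S₀ : Finset (Sym2 V)) {F : Set (BondConfig V)} (hF : IsUpperSet F)
    (hFS : ∀ (ω : BondConfig V) (e : Sym2 V), e ∈ S₀ → (insert e ω ∈ F ↔ ω ∈ F))
    (σ S : Finset (Sym2 V)) (hSσ : S ⊆ Finset.univ \ σ) (hσH : σ ⊆ insert s(s, t) E) (hSH : S ⊆ insert s(s, t) E) :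
    apPsiC q S σ (fun γ => ind {ω : BondConfig V | ∀ e ∈ S₀, e ∈ ω} (↑γ : BondConfig V))
      (fun γ => ind F (↑γ : BondConfig V)) ≤ 0 := by
  set T₀ := S₀ \ σ with hT₀
  -- the AND indicator on configurations containing `σ`
  have hval : ∀ X : Finset (Sym2 V), ind {ω : BondConfig V | ∀ e ∈ S₀, e ∈ ω} (↑(X ∪ σ) : BondConfig V) =
      if T₀ ⊆ X then 1 else 0 := by
    intro X
    by_cases hT : T₀ ⊆ X
    · rw [if_pos hT]
      refine ind_of_mem fun e he => ?_
      rw [Finset.coe_union]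
      by_cases heσ : e ∈ σ
      · exact Or.inr (Finset.mem_coe.2 heσ)
      · exact Or.inl (Finset.mem_coe.2 (hT (Finset.mem_sdiff.2 ⟨he, heσ⟩)))
    · rw [if_neg hT]
      refine ind_of_not_mem fun hall => hT fun e he => ?_
      have he' := hall e (Finset.mem_sdiff.1 he).1
      rw [Finset.coe_union] at he'
      rcases he' with h1 | h2
      · exact Finset.mem_coe.1 h1
      · exact absurd (Finset.mem_coe.1 h2) (Finset.mem_sdiff.1 he).2
  -- rewrite the cell with the reduced indicator
  have hcell : apPsiC q S σ (fun γ => ind {ω : BondConfig V | ∀ e ∈ S₀, e ∈ ω} (↑γ : BondConfig V))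
      (fun γ => ind F (↑γ : BondConfig V)) =
      apPsiC q S σ (fun γ => if T₀ ⊆ γ then (1 : ℝ) else 0) (fun γ => ind F (↑γ : BondConfig V)) := by
    unfold apPsiC
    refine Finset.sum_congr rfl fun γ _ => ?_
    have e1 : (if T₀ ⊆ γ ∪ σ then (1 : ℝ) else 0) = if T₀ ⊆ γ then 1 else 0 := by
      have : T₀ ⊆ γ ∪ σ ↔ T₀ ⊆ γ := ⟨fun h e he => (Finset.mem_union.1 (h he)).resolve_right (Finset.mem_sdiff.1 he).2,
        fun h => h.trans Finset.subset_union_left⟩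
      simp only [this]
    have e2 : (if T₀ ⊆ S \ γ ∪ σ then (1 : ℝ) else 0) = if T₀ ⊆ S \ γ then 1 else 0 := by
      have : T₀ ⊆ S \ γ ∪ σ ↔ T₀ ⊆ S \ γ := ⟨fun h e he => (Finset.mem_union.1 (h he)).resolve_right (Finset.mem_sdiff.1 he).2,
        fun h => h.trans Finset.subset_union_left⟩
      simp only [this]
    dsimp only
    rw [hval γ, hval (S \ γ), e1, e2]
  rw [hcell]
  by_cases hTS : T₀ ⊆ S
  · exact apPsiC_subsetInd_cell_nonpos hq0 hq1 hE hst hF hFS hSσ hσH hSH hTS Finset.sdiff_subset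
  -- an AND edge is deleted in this cell: the AND indicator vanishes identically
  unfold apPsiC
  refine le_of_eq (Finset.sum_eq_zero fun γ hγ => ?_)
  have e1 : (if T₀ ⊆ γ ∪ σ then (1 : ℝ) else 0) = 0 :=
    if_neg fun h => hTS fun e he => (Finset.mem_union.1 (h he)).elim (fun h1 => Finset.mem_powerset.1 hγ h1)
      fun h2 => absurd h2 (Finset.mem_sdiff.1 he).2
  have e2 : (if T₀ ⊆ S \ γ ∪ σ then (1 : ℝ) else 0) = 0 :=
    if_neg fun h => hTS fun e he => (Finset.mem_union.1 (h he)).elim (fun h1 => Finset.sdiff_subset h1)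
      fun h2 => absurd h2 (Finset.mem_sdiff.1 he).2
  dsimp only
  rw [e1, e2, sub_self, zero_mul, mul_zero]

/-- **Every cell of `Z² Cov(1{some edge of S₀ open}, 1_F)` inside a 2-connected series–parallel host is `≤ 0`** (`0 < q ≤ 1`, `F`
increasing and not reading `S₀`): if an edge of `S₀` is contracted in the cell (`S₀ ∩ σ ≠ ∅`) the OR indicator is identically `1` there and
the cell vanishes; otherwise its antipodal increments coincide with those of the AND indicator `1{S₀ ∩ S ⊆ ·}` (`F_or = F_and`: the OR
event is the dual of the AND event) and `apPsiC_subsetInd_cell_nonpos` applies.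
[cite: Grimmett2006, §3.8 Thm. (3.90) (pp. 61–62); §3.9 (pp. 63–64)] -/
theorem apPsiC_orEvent_cell_nonpos {q : ℝ} (hq0 : 0 < q) (hq1 : q ≤ 1) {E : Finset (Sym2 V)} (hE : IsTTSP E s t)
    (hst : s(s, t) ∉ E) (S₀ : Finset (Sym2 V)) {F : Set (BondConfig V)} (hF : IsUpperSet F)
    (hFS : ∀ (ω : BondConfig V) (e : Sym2 V), e ∈ S₀ → (insert e ω ∈ F ↔ ω ∈ F))
    (σ S : Finset (Sym2 V)) (hSσ : S ⊆ Finset.univ \ σ) (hσH : σ ⊆ insert s(s, t) E) (hSH : S ⊆ insert s(s, t) E) :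
    apPsiC q S σ (fun γ => ind {ω : BondConfig V | ∃ e ∈ S₀, e ∈ ω} (↑γ : BondConfig V))
      (fun γ => ind F (↑γ : BondConfig V)) ≤ 0 := by
  by_cases hσ0 : ∃ e ∈ S₀, e ∈ σ
  · -- an OR edge is contracted in this cell: the OR indicator is identically `1`
    obtain ⟨e, he0, heσ⟩ := hσ0
    have hone : ∀ X : Finset (Sym2 V), ind {ω : BondConfig V | ∃ e ∈ S₀, e ∈ ω} (↑(X ∪ σ) : BondConfig V) = 1 :=
      fun X => ind_of_mem ⟨e, he0, by rw [Finset.coe_union]; exact Or.inr (Finset.mem_coe.2 heσ)⟩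
    unfold apPsiC
    refine le_of_eq (Finset.sum_eq_zero fun γ _ => ?_)
    dsimp only
    rw [hone γ, hone (S \ γ), sub_self, zero_mul, mul_zero]
  have hσ0' : ∀ e ∈ S₀, e ∉ σ := fun e he heσ => hσ0 ⟨e, he, heσ⟩
  set T₀ := S₀ ∩ S with hT₀
  -- the OR indicator on configurations containing `σ`, for `X ⊆ S`
  have hval : ∀ X : Finset (Sym2 V), X ⊆ S → ind {ω : BondConfig V | ∃ e ∈ S₀, e ∈ ω} (↑(X ∪ σ) : BondConfig V) =
      1 - (if T₀ ⊆ S \ X then 1 else 0) := by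
    intro X hXS
    by_cases hT : T₀ ⊆ S \ X
    · rw [if_pos hT, sub_self]
      refine ind_of_not_mem ?_
      rintro ⟨e, he0, heX⟩
      rw [Finset.coe_union] at heX
      rcases heX with h1 | h2
      · exact (Finset.mem_sdiff.1 (hT (Finset.mem_inter.2 ⟨he0, hXS (Finset.mem_coe.1 h1)⟩))).2 (Finset.mem_coe.1 h1)
      · exact hσ0' e he0 (Finset.mem_coe.1 h2)
    · rw [if_neg hT, sub_zero]
      obtain ⟨e, heT, heX⟩ := Finset.not_subset.1 hT
      refine ind_of_mem ⟨e, (Finset.mem_inter.1 heT).1, ?_⟩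
      rw [Finset.coe_union]
      refine Or.inl (Finset.mem_coe.2 ?_)
      by_contra h
      exact heX (Finset.mem_sdiff.2 ⟨(Finset.mem_inter.1 heT).2, h⟩)
  -- the OR increments are the AND increments of `1{T₀ ⊆ ·}`
  have hcell : apPsiC q S σ (fun γ => ind {ω : BondConfig V | ∃ e ∈ S₀, e ∈ ω} (↑γ : BondConfig V))
      (fun γ => ind F (↑γ : BondConfig V)) =
      apPsiC q S σ (fun γ => if T₀ ⊆ γ then (1 : ℝ) else 0) (fun γ => ind F (↑γ : BondConfig V)) := by
    unfold apPsiC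
    refine Finset.sum_congr rfl fun γ hγ => ?_
    have hγS := Finset.mem_powerset.1 hγ
    have e1 : (if T₀ ⊆ γ ∪ σ then (1 : ℝ) else 0) = if T₀ ⊆ γ then 1 else 0 := by
      have : T₀ ⊆ γ ∪ σ ↔ T₀ ⊆ γ := ⟨fun h e he => (Finset.mem_union.1 (h he)).resolve_right (hσ0' e (Finset.mem_inter.1 he).1),
        fun h => h.trans Finset.subset_union_left⟩
      simp only [this]
    have e2 : (if T₀ ⊆ S \ γ ∪ σ then (1 : ℝ) else 0) = if T₀ ⊆ S \ γ then 1 else 0 := by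
      have : T₀ ⊆ S \ γ ∪ σ ↔ T₀ ⊆ S \ γ := ⟨fun h e he => (Finset.mem_union.1 (h he)).resolve_right (hσ0' e (Finset.mem_inter.1 he).1),
        fun h => h.trans Finset.subset_union_left⟩
      simp only [this]
    dsimp only
    rw [hval γ hγS, hval (S \ γ) Finset.sdiff_subset, sdiff_sdiff_eq_self hγS, e1, e2]
    ring
  rw [hcell]
  exact apPsiC_subsetInd_cell_nonpos hq0 hq1 hE hst hF hFS hSσ hσH hSH Finset.inter_subset_right Finset.inter_subset_left

end Cells

/-! ### The theorem -/

/-- **THEOREM (AND events vs increasing events under `φ_{w,q}`, `q ≤ 1`, on 2-connected series–parallel graphs).**  Let `E` be a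
two-terminal series–parallel network between `s` and `t` with `st ∉ E`, let the edge weights `w ∈ [0,1]^{Sym2 V}` vanish off `H = E ∪ {st}`
(an arbitrary 2-connected series–parallel weighted graph; Duffin), `0 < q ≤ 1`, `S₀` any finite edge set and `F` any increasing event not
depending on the edges of `S₀`.  Then `φ_{w,q}({S₀ open} ∩ F) ≤ φ_{w,q}(S₀ open) · φ_{w,q}(F)` — every AND event is negatively correlated
with every increasing event off its support (for `|S₀| = 1`: single-edge negative dependence, gen 8).  Proof: fk-3's antipodal bridge
restricted to the support + file 32c's coefficientwise theorem cell by cell (`apPsiC_andEvent_cell_nonpos`).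
[cite: Grimmett2006, §1.4 eq. (1.20) (p. 15); §3.8 Thm. (3.90) (pp. 61–62); §3.9 (pp. 63–64)] [cite: Wagner2006, Thm. 5.8(d), §5.3] -/
theorem rcMeasureW_and_inter_le_of_isTTSP {q : ℝ} (hq0 : 0 < q) (hq1 : q ≤ 1) {E : Finset (Sym2 V)} {s t : V}
    (hE : IsTTSP E s t) (hst : s(s, t) ∉ E) (w : Sym2 V → unitInterval) (hw : ∀ e, e ∉ insert s(s, t) E → ((w e : ℝ)) = 0)
    (S₀ : Finset (Sym2 V)) {F : Set (BondConfig V)} (hF : IsUpperSet F)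
    (hFS : ∀ (ω : BondConfig V) (e : Sym2 V), e ∈ S₀ → (insert e ω ∈ F ↔ ω ∈ F)) :
    (rcMeasureW w q ∅).real ({ω : BondConfig V | ∀ e ∈ S₀, e ∈ ω} ∩ F) ≤
      (rcMeasureW w q ∅).real {ω : BondConfig V | ∀ e ∈ S₀, e ∈ ω} * (rcMeasureW w q ∅).real F :=
  rcMeasureW_real_inter_le_of_apPsiC_nonpos_on hq0 w (insert s(s, t) E) hw _ F fun σ S hSσ hσ hS =>
    apPsiC_andEvent_cell_nonpos hq0 hq1 hE hst S₀ hF hFS σ S hSσ hσ hS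

/-- **THEOREM (OR events vs increasing events under `φ_{w,q}`, `q ≤ 1`, on 2-connected series–parallel graphs).**  Same setting; for every
finite edge set `S₀` and every increasing event `F` not depending on the edges of `S₀`:
`φ_{w,q}({some edge of S₀ is open} ∩ F) ≤ φ_{w,q}(some edge of S₀ is open) · φ_{w,q}(F)`.  The OR event is the dual of the AND event, so its
antipodal increments are the AND increments (`apPsiC_orEvent_cell_nonpos`); the bridge is the same.
[cite: Grimmett2006, §1.4 eq. (1.20) (p. 15); §3.8 Thm. (3.90) (pp. 61–62); §3.9 (pp. 63–64)] [cite: Wagner2006, Thm. 5.8(d), §5.3] -/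
theorem rcMeasureW_or_inter_le_of_isTTSP {q : ℝ} (hq0 : 0 < q) (hq1 : q ≤ 1) {E : Finset (Sym2 V)} {s t : V}
    (hE : IsTTSP E s t) (hst : s(s, t) ∉ E) (w : Sym2 V → unitInterval) (hw : ∀ e, e ∉ insert s(s, t) E → ((w e : ℝ)) = 0)
    (S₀ : Finset (Sym2 V)) {F : Set (BondConfig V)} (hF : IsUpperSet F)
    (hFS : ∀ (ω : BondConfig V) (e : Sym2 V), e ∈ S₀ → (insert e ω ∈ F ↔ ω ∈ F)) :
    (rcMeasureW w q ∅).real ({ω : BondConfig V | ∃ e ∈ S₀, e ∈ ω} ∩ F) ≤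
      (rcMeasureW w q ∅).real {ω : BondConfig V | ∃ e ∈ S₀, e ∈ ω} * (rcMeasureW w q ∅).real F :=
  rcMeasureW_real_inter_le_of_apPsiC_nonpos_on hq0 w (insert s(s, t) E) hw _ F fun σ S hSσ hσ hS =>
    apPsiC_orEvent_cell_nonpos hq0 hq1 hE hst S₀ hF hFS σ S hSσ hσ hS

end FK

end Summit.CriticalPhenomena.PercolationContinuityZ3.Theorems

end
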